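import Summits.ResolutionOfSingularities.ResolutionOfSingularities.Theorems.FrobeniusLadderFInjectiveMacaulayficationTestIdealTransport
import Summits.ResolutionOfSingularities.ResolutionOfSingularities.Theorems.FrobeniusLadderFInjectiveMacaulayficationLx6q7PointFloor
import Summits.ResolutionOfSingularities.ResolutionOfSingularities.Theorems.FrobeniusLadderFInjectiveMacaulayficationFTemkinClosedPoints
import Summits.ResolutionOfSingularities.ResolutionOfSingularities.Theorems.FrobeniusLadderFInjectiveMacaulayficationFermatCubicConeGerm
import HarnessLib

/-!
# NEG-T-τ: local → global transfer of rad-τ towers, and the TT-τ kernel record with `hfloor` AND `hloc` DISCHARGED on the refuting bed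
# (crux `FInjectiveMacaulayfication` stmt-ResolutionOfSingularities-15315, chain w45a; res-L1-w45a-plan-1 R21.3 (3) Q5 «(L-f) τ-twin of (T1)», part 2; seat res-L1-w45a-lead-1 g10)

[OURS · L1 W4.5a] Support file (`--supports stmt-ResolutionOfSingularities-15315 --as helper`); def-free, fact-free. §1–§2 UNCONDITIONAL; §3 CONDITIONAL by design. Nothing of the
crux is proved; `TauTowerConjecture` (OUR OWN candidate) stays refuted BY EVIDENCE only (R19.16). AI-written (AI review is weaker than expert review).

* §1 ★ `tower_of_flat_preimmersion₂` — the generic transfer of ✓ p646420 with the off-range INVARIANT `P` separated from the tower's TERMINAL predicate `Q` (`P ⇒ Q`; the centre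
  supported inside the closure of the `P`-bad locus; (T1) along flat preimmersions whose range contains that closure). Needed because the rad-τ centre is NOT supported inside
  the closure of the non-FULL locus (non-F-regular FULL points exist), only inside the singular locus: take `P :=` «regular ∧ FULL», `Q :=` FULL.
* §2 ★★ `recipeTowerFull_tauCentre_of_pullback_fromSpecStalk` / `exists_…` — NEG-T FOR rad τ, HYPOTHESIS-FREE: `h : T ⟶ X`, `v` closed, `T` regular and FULL off `h⁻¹ v` ⟹ every
  rad-τ tower bound on the LOCAL floor `T ×_X Spec 𝒪_{X,v}` is a bound on `T` ((T1) = `TestIdealTransport.tauCentre_comap_of_sing`).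
* §3 ★★ `not_tauTowerConjecture_of_cycle_and_prefix` — the (L-f) record on the refuting bed d4lx6q7 = {z²+x⁶z+y³+u³+t⁷} (char 2) with `hfloor` DISCHARGED (NEG-0-τ ✓ p639147
  `Lx6q7PointFloor.tauTower_at_pointFloor` ∘ §2) and `hloc` DISCHARGED (part 1): the global floor `F 0` is ANY blowing up of the bed along `𝔪`. WHAT REMAINS CONDITIONAL, exactly:
  (a) the two blowing ups of the loop germs `U_L`, `U_M` ALONG `tauCentre 2` receiving the other germ as an open chart; (b) the occurrence prefix `F 1 … F m` of blowing ups ALONG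
  `tauCentre 2` with a non-FULL point on each floor and `U_L ⊆° F m` — every item a TEST-IDEAL IDENTIFICATION on an explicit chart (R19.7-DEFERRED-1), nothing else.
[folklore assembly; cite: GortzWedhorn2020, Prop. 13.91 (2)] [cite: Temkin2008, §2.1] [cite: StacksProject, Tag 01J3; Tag 080B]
-/

-- single-problem summit: the doubled namespace component is forced
set_option linter.dupNamespace false

noncomputable section

open AlgebraicGeometry CategoryTheory CategoryTheory.Limits Literature.AlgebraicGeometry.Resolution TopologicalSpace IsLocalRing MvPolynomial

namespace Summit.ResolutionOfSingularities.ResolutionOfSingularities.Theorems.FInjectiveMacaulayfication.TestIdealTransport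

open Summit.ResolutionOfSingularities.ResolutionOfSingularities.Theorems.FInjectiveMacaulayfication
open SliceableCentre IntrinsicTower IntrinsicTower.Recipes FullCentreDescent RecipeTowerTransfer

/-! ## §1 The generic transfer with a separate off-range invariant -/

/-- ★ **TOWER TRANSFER ALONG A FLAT PREIMMERSION, two predicates.** `P` (the off-range invariant) and `Q` (the tower's terminal predicate) are point properties invariant under
isomorphic stalk maps with `P ⇒ Q`; the centre `c S` is supported inside the closure of the `P`-bad locus; (T1) `hcomap` along flat preimmersions whose range contains that
closure. THEN for a flat preimmersion `f : S′ ⟶ S` and a closed `Z ⊆ range f` off which `S` is `P`-good: `T n S′ → T n S`. (✓ p646420 `tower_of_flat_preimmersion` is `P = Q`.)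
[OURS · folklore assembly] -/
theorem tower_of_flat_preimmersion₂ (P Q : (S : Scheme.{0}) → S → Prop) (hPQ : ∀ (S : Scheme.{0}) (s : S), P S s → Q S s)
    (hP : ∀ {X Y : Scheme.{0}} (π : X ⟶ Y) (x : X) [IsIso (π.stalkMap x)], P Y (π.base x) ↔ P X x)
    (hQ : ∀ {X Y : Scheme.{0}} (π : X ⟶ Y) (x : X) [IsIso (π.stalkMap x)], Q Y (π.base x) ↔ Q X x)
    (T : ℕ → Scheme.{0} → Prop) (c : (S : Scheme.{0}) → S.IdealSheafData)
    (h0 : ∀ (S : Scheme.{0}), T 0 S ↔ ∀ s : S, Q S s)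
    (hsucc : ∀ (n : ℕ) (S : Scheme.{0}), T (n + 1) S ↔ ∀ (S₁ : Scheme.{0}) (g : S₁ ⟶ S), IsBlowup g (c S) → T n S₁)
    (hsupp : ∀ (S : Scheme.{0}), ((c S).support : Set S) ⊆ closure {s : S | ¬ P S s})
    (hcomap : ∀ {S S' : Scheme.{0}} (f : S' ⟶ S) [Flat f] [IsPreimmersion f], closure {s : S | ¬ P S s} ⊆ Set.range f.base → (c S).comap f = c S') :
    ∀ (n : ℕ) (S S' : Scheme.{0}) (f : S' ⟶ S) [Flat f] [IsPreimmersion f] (Z : Set S),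
      IsClosed Z → Z ⊆ Set.range f.base → (∀ s : S, s ∉ Z → P S s) → T n S' → T n S := by
  intro n
  induction n with
  | zero =>
    intro S S' f _ _ Z _ hZ hgood hT
    rw [h0] at hT ⊢
    intro s
    by_cases hs : s ∈ Z
    · obtain ⟨s', rfl⟩ := hZ hs
      haveI := isIso_stalkMap_of_flat_of_isPreimmersion f s'
      exact (hQ f s').mpr (hT s')
    · exact hPQ S s (hgood s hs)
  | succ n ih =>
    intro S S' f _ _ Z hZc hZ hgood hT
    rw [hsucc] at hT ⊢
    intro S₁ g hg
    have hbadZ : closure {s : S | ¬ P S s} ⊆ Z := hZc.closure_subset_iff.mpr fun s hs => by_contra fun hsZ => hs (hgood s hsZ)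
    have hg' : IsBlowup (pullback.snd g f) (c S') := by
      rw [← hcomap f (hbadZ.trans hZ)]
      exact hg.pullback_snd_of_flat f
    have hT₁ : T n (pullback g f) := hT _ _ hg'
    refine ih S₁ (pullback g f) (pullback.fst g f) (g.base ⁻¹' Z) (hZc.preimage g.base.hom.continuous) ?_ ?_ hT₁
    · intro s₁ hs₁
      rw [Scheme.Pullback.range_fst]
      exact hZ hs₁
    · intro s₁ hs₁
      have hns : g.base s₁ ∉ ((c S).support : Set S) := fun h => hs₁ (hbadZ (hsupp S h))
      haveI := isIso_stalkMap_of_isBlowup_of_not_mem hg s₁ hns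
      exact (hP g s₁).mp (hgood _ hs₁)

/-! ## §2 ★★ NEG-T for the rad-τ recipe, hypothesis-free -/

/-- Regularity ASCENDS along an isomorphic stalk map (companion of `mem_regularLocus_descends`). [folklore] -/
theorem mem_regularLocus_ascends {X Y : Scheme.{0}} (π : X ⟶ Y) (x : X) [IsIso (π.stalkMap x)]
    (h : x ∈ Scheme.regularLocus X) : π.base x ∈ Scheme.regularLocus Y := by
  change IsRegularLocalRing (X.presheaf.stalk x) at h
  change IsRegularLocalRing (Y.presheaf.stalk (π.base x))
  exact IsRegularLocalRing.of_ringEquiv (asIso (π.stalkMap x)).commRingCatIsoToRingEquiv.symm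

/-- «regular ∧ FULL» is invariant under isomorphic stalk maps. [folklore] -/
theorem regFull_iff_of_isIso_stalkMap (p : ℕ) {X Y : Scheme.{0}} (π : X ⟶ Y) (x : X) [IsIso (π.stalkMap x)] :
    (π.base x ∈ Scheme.regularLocus Y ∧ FullCl p (Y.presheaf.stalk (π.base x))) ↔ (x ∈ Scheme.regularLocus X ∧ FullCl p (X.presheaf.stalk x)) :=
  and_congr ⟨fun h => mem_regularLocus_descends π x h, fun h => mem_regularLocus_ascends π x h⟩ (fullCl_stalk_iff_of_isIso_stalkMap p π x)

/-- The singular locus lies in the «regular ∧ FULL»-bad locus (closures). [folklore] -/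
theorem closure_compl_regularLocus_subset (p : ℕ) (S : Scheme.{0}) :
    closure ((Scheme.regularLocus S)ᶜ) ⊆ closure {s : S | ¬ (s ∈ Scheme.regularLocus S ∧ FullCl p (S.presheaf.stalk s))} :=
  closure_mono fun _ hs h => hs h.1

/-- The rad-τ centre is supported inside the closure of the «regular ∧ FULL»-bad locus (it is Sing-supported). [OURS] -/
theorem support_tauCentre_subset_closure_not_regFull (p : ℕ) (S : Scheme.{0}) :
    ((tauCentre p S).support : Set S) ⊆ closure {s : S | ¬ (s ∈ Scheme.regularLocus S ∧ FullCl p (S.presheaf.stalk s))} :=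
  (singSupported_tauCentre p S).trans (closure_compl_regularLocus_subset p S)

/-- ★ **TRANSFER FOR rad-τ TOWERS along a flat preimmersion** `f : S′ ⟶ S` with `S` regular and FULL off a closed `Z ⊆ range f`. [OURS] -/
theorem recipeTowerFull_tauCentre_of_flat_preimmersion (p : ℕ) (n : ℕ) {S S' : Scheme.{0}} (f : S' ⟶ S) [Flat f] [IsPreimmersion f]
    (Z : Set S) (hZc : IsClosed Z) (hZ : Z ⊆ Set.range f.base)
    (hfine : ∀ s : S, s ∉ Z → s ∈ Scheme.regularLocus S ∧ FullCl p (S.presheaf.stalk s))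
    (hT : RecipeTowerFull tauCentre p n S') : RecipeTowerFull tauCentre p n S :=
  tower_of_flat_preimmersion₂ (fun S s => s ∈ Scheme.regularLocus S ∧ FullCl p (S.presheaf.stalk s)) (fun S s => FullCl p (S.presheaf.stalk s))
    (fun _ _ h => h.2) (fun π x _ => regFull_iff_of_isIso_stalkMap p π x) (fun π x _ => fullCl_stalk_iff_of_isIso_stalkMap p π x)
    (RecipeTowerFull tauCentre p) (tauCentre p) (fun _ => Iff.rfl) (fun _ _ => Iff.rfl) (support_tauCentre_subset_closure_not_regFull p)
    (fun f _ _ h => tauCentre_comap_of_sing p f ((closure_compl_regularLocus_subset p _).trans h)) n S S' f Z hZc hZ hfine hT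

/-- ★★ **NEG-T FOR rad τ, pro-open form, HYPOTHESIS-FREE.** `h : T ⟶ X`, `v ∈ X` closed, `T` regular and FULL at every point not over `v`: every bound on the rad-τ towers of the
LOCAL floor `T ×_X Spec 𝒪_{X,v}` is a bound on the rad-τ towers of `T`. [OURS · GW 13.91 (2), Temkin 2008 §2.1] -/
theorem recipeTowerFull_tauCentre_of_pullback_fromSpecStalk (p : ℕ) {X T : Scheme.{0}} (h : T ⟶ X) (v : X) (hv : IsClosed ({v} : Set X))
    (hfine : ∀ s : T, h.base s ≠ v → s ∈ Scheme.regularLocus T ∧ FullCl p (T.presheaf.stalk s)) (n : ℕ)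
    (hT : RecipeTowerFull tauCentre p n (pullback h (X.fromSpecStalk v))) : RecipeTowerFull tauCentre p n T := by
  haveI : Flat (X.fromSpecStalk v) := flat_fromSpecStalk X v
  refine recipeTowerFull_tauCentre_of_flat_preimmersion p n (pullback.fst h (X.fromSpecStalk v)) (h.base ⁻¹' {v}) (hv.preimage h.base.hom.continuous) ?_
    (fun s hs => hfine s hs) hT
  intro s hs
  exact mem_range_pullback_fst_fromSpecStalk_of_eq (π := h) (x := v) hs

/-- The same with an existential height. [OURS] -/
theorem exists_recipeTowerFull_tauCentre_of_pullback_fromSpecStalk (p : ℕ) {X T : Scheme.{0}} (h : T ⟶ X) (v : X) (hv : IsClosed ({v} : Set X))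
    (hfine : ∀ s : T, h.base s ≠ v → s ∈ Scheme.regularLocus T ∧ FullCl p (T.presheaf.stalk s))
    (hT : ∃ n : ℕ, RecipeTowerFull tauCentre p n (pullback h (X.fromSpecStalk v))) : ∃ n : ℕ, RecipeTowerFull tauCentre p n T := by
  obtain ⟨n, hn⟩ := hT
  exact ⟨n, recipeTowerFull_tauCentre_of_pullback_fromSpecStalk p h v hv hfine n hn⟩

/-! ## §3 ★★ The (L-f) record on the refuting bed with `hfloor` and `hloc` discharged -/

/-- `hfloor` DISCHARGED on the bed d4lx6q7: for ANY blowing up `h : T ⟶ X` of `X = {z²+x⁶z+y³+u³+t⁷}` (char 2) along `𝔪`, the rad-τ conjecture bounds the rad-τ towers of `T`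
(NEG-0-τ ✓ p639147 at the local floor `T ×_X Spec 𝒪_{X,v}`, then §2; `T` is regular — hence FULL — off the fibre of `v` because the blowing up is a stalk isomorphism off `supp 𝔪 = {v}`
and `X` is regular off `v`). [OURS · unconditional implication from OUR candidate statement] -/
theorem tauTower_at_globalFloor (hTT : TauTowerConjecture) (k : Type) [Field k] [CharP k 2]
    (f : MvPolynomial (Fin 5) k) (hf : f = X 4 ^ 2 + X 0 ^ 6 * X 4 + X 1 ^ 3 + X 2 ^ 3 + X 3 ^ 7)
    (v : Spec (.of (MvPolynomial (Fin 5) k ⧸ Ideal.span {f})))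
    (hv : v.asIdeal = Ideal.span (Set.range fun j : Fin 5 => Ideal.Quotient.mk (Ideal.span {f}) (X j)))
    {T : Scheme.{0}} (h : T ⟶ Spec (.of (MvPolynomial (Fin 5) k ⧸ Ideal.span {f})))
    (hT : IsBlowup h (affineBlowup.idealSheaf (Ideal.span (Set.range fun j : Fin 5 => Ideal.Quotient.mk (Ideal.span {f}) (X j))))) :
    ∃ n : ℕ, RecipeTowerFull tauCentre 2 n T := by
  classical
  haveI : Fact (Nat.Prime 2) := ⟨Nat.prime_two⟩
  haveI : Flat ((Spec (.of (MvPolynomial (Fin 5) k ⧸ Ideal.span {f}))).fromSpecStalk v) := flat_fromSpecStalk _ v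
  refine exists_recipeTowerFull_tauCentre_of_pullback_fromSpecStalk 2 h v (Lx6q7Specimen.isClosed_vertex k f hf v hv) ?_
    (Lx6q7PointFloor.tauTower_at_pointFloor hTT k f hf v hv _ (pullback.snd h _) (hT.pullback_snd_of_flat _))
  intro s hs
  have hM : (Ideal.span (Set.range fun j : Fin 5 => Ideal.Quotient.mk (Ideal.span {f}) (X j))).IsMaximal :=
    DoublePointFermatCubicGerm.isMaximal_origin k f (Lx6q7Specimen.constantCoeff_f k f hf)
  have hne : ¬ Ideal.span (Set.range fun j : Fin 5 => Ideal.Quotient.mk (Ideal.span {f}) (X j)) ≤ (h.base s).asIdeal := by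
    intro hle
    exact hs (PrimeSpectrum.ext ((hM.eq_of_le (h.base s).isPrime.ne_top hle).symm.trans hv.symm))
  have hnot : h.base s ∉ ((affineBlowup.idealSheaf (Ideal.span (Set.range fun j : Fin 5 => Ideal.Quotient.mk (Ideal.span {f}) (X j)))).support :
      Set (Spec (.of (MvPolynomial (Fin 5) k ⧸ Ideal.span {f})))) := by
    rw [affineBlowup.support_idealSheaf]
    intro hmem
    exact hne (SetLike.coe_subset_coe.mp ((PrimeSpectrum.mem_zeroLocus (h.base s) _).mp hmem))
  haveI := hT.isIso_stalkMap_of_not_mem_support hnot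
  have hreg : h.base s ∈ Scheme.regularLocus (Spec (.of (MvPolynomial (Fin 5) k ⧸ Ideal.span {f}))) :=
    FermatCubicConeGerm.mem_regularLocus_Spec_of_isRegularLocalRing _ (Lx6q7Specimen.regular_off_vertex k f hf _ hne)
  haveI : IsRegularLocalRing ((Spec (.of (MvPolynomial (Fin 5) k ⧸ Ideal.span {f}))).presheaf.stalk (h.base s)) := hreg
  haveI : CharP ((Spec (.of (MvPolynomial (Fin 5) k ⧸ Ideal.span {f}))).presheaf.stalk (h.base s)) 2 :=
    FTemkinClosedPoints.charP_stalk_of_over 2 (Spec.map (CommRingCat.ofHom (algebraMap k (MvPolynomial (Fin 5) k ⧸ Ideal.span {f})))) (𝟙 _) (h.base s)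
  exact ⟨mem_regularLocus_of_isIso_stalkMap h s hreg,
    FTemkinClosedPoints.fullCl_of_isIso_stalkMap' 2 h s (FTemkinClosedPoints.fullCl_of_isRegularLocalRing 2 _)⟩

end Summit.ResolutionOfSingularities.ResolutionOfSingularities.Theorems.FInjectiveMacaulayfication.TestIdealTransport

namespace Summit.ResolutionOfSingularities.ResolutionOfSingularities.Theorems.FInjectiveMacaulayfication.RadTauLoopConditional

open Summit.ResolutionOfSingularities.ResolutionOfSingularities.Theorems.FInjectiveMacaulayfication
open SliceableCentre IntrinsicTower IntrinsicTower.Recipes FullCentreDescent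

/-- ★★ **THE (L-f) KERNEL RECORD ON THE REFUTING BED, `hfloor`- AND `hloc`-FREE.** Bed `X = {z²+x⁶z+y³+u³+t⁷} ⊂ 𝔸⁵` over a field of characteristic 2, `v` the vertex, `F 0 ⟶ X` ANY
blowing up along `𝔪` (the admissible point floor, ✓ p639147). GIVEN (a) the two certified rad-τ blowing ups of the loop germs `U_L`, `U_M` (each receiving the other as an open
chart) and (b) an occurrence prefix `F 0 ← F 1 ← … ← F m` of blowing ups along `tauCentre 2` with a non-FULL point on every floor `i < m` and `U_L ⊆° F m`, the rad-τ tower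
conjecture `TauTowerConjecture` is FALSE. Every remaining hypothesis is a TEST-IDEAL IDENTIFICATION on an explicit chart (R19.7-DEFERRED-1); the loop itself is idea-1 FB5-r7 /
tri-2's replay (R19.16, evidence). [OURS · CONDITIONAL on (a)(b); settles nothing] -/
theorem not_tauTowerConjecture_of_cycle_and_prefix (k : Type) [Field k] [CharP k 2]
    (f : MvPolynomial (Fin 5) k) (hf : f = X 4 ^ 2 + X 0 ^ 6 * X 4 + X 1 ^ 3 + X 2 ^ 3 + X 3 ^ 7)
    (v : Spec (.of (MvPolynomial (Fin 5) k ⧸ Ideal.span {f})))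
    (hv : v.asIdeal = Ideal.span (Set.range fun j : Fin 5 => Ideal.Quotient.mk (Ideal.span {f}) (X j)))
    (L M : MvPolynomial (Fin 5) k)
    (hL : L = X 4 ^ 2 + X 0 ^ 2 * X 2 * X 4 + X 0 * X 2 ^ 2 + X 0 * X 2 * X 3 ^ 2 + X 0 * X 1 ^ 3 * X 2 ^ 2)
    (hM : M = X 4 ^ 2 + X 0 ^ 2 * X 2 * X 4 + X 0 * X 2 ^ 2 + X 0 ^ 2 * X 2 * X 3 ^ 2 + X 0 * X 1 ^ 3 * X 2 ^ 2)
    (BL : Scheme.{0}) (πL : BL ⟶ Spec (.of (MvPolynomial (Fin 5) k ⧸ Ideal.span {L})))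
    (hπL : IsBlowup πL (tauCentre 2 (Spec (.of (MvPolynomial (Fin 5) k ⧸ Ideal.span {L})))))
    (jM : Spec (.of (MvPolynomial (Fin 5) k ⧸ Ideal.span {M})) ⟶ BL) [IsOpenImmersion jM]
    (BM : Scheme.{0}) (πM : BM ⟶ Spec (.of (MvPolynomial (Fin 5) k ⧸ Ideal.span {M})))
    (hπM : IsBlowup πM (tauCentre 2 (Spec (.of (MvPolynomial (Fin 5) k ⧸ Ideal.span {M})))))
    (jL : Spec (.of (MvPolynomial (Fin 5) k ⧸ Ideal.span {L})) ⟶ BM) [IsOpenImmersion jL]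
    (m : ℕ) (F : ℕ → Scheme.{0}) (g' : ∀ i : ℕ, F (i + 1) ⟶ F i)
    (h₀ : F 0 ⟶ Spec (.of (MvPolynomial (Fin 5) k ⧸ Ideal.span {f})))
    (hF₀ : IsBlowup h₀ (affineBlowup.idealSheaf (Ideal.span (Set.range fun j : Fin 5 => Ideal.Quotient.mk (Ideal.span {f}) (X j)))))
    (hg' : ∀ i, i < m → IsBlowup (g' i) (tauCentre 2 (F i)))
    (hbad : ∀ i, i < m → ∃ s : F i, ¬ FullCl 2 ((F i).presheaf.stalk s))
    (hocc : ∃ j : Spec (.of (MvPolynomial (Fin 5) k ⧸ Ideal.span {L})) ⟶ F m, IsOpenImmersion j) :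
    ¬ TauTowerConjecture :=
  not_tauTowerConjecture_of_global_cycle_data' k L M hL hM BL πL hπL jM BM πM hπM jL m F g'
    (fun hTT => TestIdealTransport.tauTower_at_globalFloor hTT k f hf v hv h₀ hF₀) hg' hbad hocc

end Summit.ResolutionOfSingularities.ResolutionOfSingularities.Theorems.FInjectiveMacaulayfication.RadTauLoopConditional

end
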